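import Summits.BirchSwinnertonDyer.BirchSwinnertonDyer.Theorems.GenusKolyvaginAtTwoTorsionCellD0TripleTwistUnramified
import HarnessLib

/-!
# D0≤2: residue pairs of positive Selmer classes of the rank-zero base

Crux R″ `RankOneTwoTorsionResidualAtTwo` (stmt-27478), LINE 49 «full_vertex», stub D0≤2
`FullTorsionGenusSelmerLawUpToTwoAtTwo`. For the base `E/ℚ` with rational `2`-torsion `e₁ < e₂ < e₃`, rank `0` and
`Ш(E)[2] = 0` one has `Sel⁽²⁾(E/ℚ) = κ(E[2]) = {0, κ(T₁), κ(T₂), κ(T₃)}`; at a prime `q` with `qr_q(−1) = 1` where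
`δ₁, δ₂` are non-residues the residue pairs of these four classes are `(0,0), (1,t+1), (t,1), (t+1,t)`,
`t = qr_q(e₂−e₁)`. **`qrBit_pair_of_mem_selmerGroup_of_pos`**: a Selmer class whose `T₂`-component is POSITIVE is
`0` or `κ(T₃)` (the classes `κ(T₁) ∋ [e₁−e₂]`, `κ(T₂) ∋ [δ₂]` have negative `T₂`-component), so its residue pair is
`(0,0)` or `(t+1,t)` — the "aligned-class constraint" used in the `2`-descent for `C₁ = E₀^{(−p₀q₁q₂)}`
(`…D0TripleTwistBound`). Also `twoDescentClass_mul` (additivity of `c(a,b)`).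

Everything is proved; no LINE 49 statement is restated; BSD is not advanced by this file alone.

## References

* [SilvermanAEC2009] J. H. Silverman, *The Arithmetic of Elliptic Curves*, 2nd ed., GTM 106, Prop. X.1.4, X.4.9.
-/

noncomputable section

open scoped Classical

namespace Summit.BirchSwinnertonDyer.BirchSwinnertonDyer.Theorems.GenusKolyvaginAtTwo.TorsionCellD0

open WeierstrassCurve WeierstrassCurve.Affine WeierstrassCurve.Affine.Point
open Literature.NumberTheory.GaloisRepresentations Literature.NumberTheory.EllipticCurves Field
open Literature.NumberTheory.EllipticCurves.TwoDescentLocal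
open Literature.NumberTheory.EllipticCurves.KramerTwoDescent
open IsDedekindDomain NumberField Rat.HeightOneSpectrum

variable (E : WeierstrassCurve ℚ) [E.IsElliptic] {e₁ e₂ e₃ : ℚ}

/-! ## Residue pairs of positive Selmer classes of the rank-zero base -/

section Base

/-- A bit of `ℤ/2` is `0` or `1`. [folklore] -/
private theorem zmod2_cases (x : ZMod 2) : x = 0 ∨ x = 1 := by revert x; decide

/-- Additivity of `c(a, b)` in the pair. [cite: SilvermanAEC2009, Prop. X.1.4] -/
theorem twoDescentClass_mul (h : E.toAffine.SplitTwoTorsion e₁ e₂ e₃) (a a' b b' : ℚˣ) :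
    E.twoDescentClass h (a * a') (b * b') = E.twoDescentClass h a b + E.twoDescentClass h a' b' :=
  (E.eq_twoDescentClass_of_kummerEquiv_eq h (a * a') (b * b')
    (E.kummerEquiv_twoTorsionCharH1_add h a a' (E.kummerEquiv_twoTorsionCharH1_twoDescentClass h a b)
      (E.kummerEquiv_twoTorsionCharH1_twoDescentClass h a' b'))
    (E.kummerEquiv_twoTorsionCharH1_add h.swap₁₂ b b' (E.kummerEquiv_twoTorsionCharH1_swap_twoDescentClass h a b)
      (E.kummerEquiv_twoTorsionCharH1_swap_twoDescentClass h a' b'))).symm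

/-- A square class equal to `1` is a positive rational. [folklore] -/
private theorem pos_of_mk_eq_one {x : ℚˣ} (hx : (QuotientGroup.mk x : SqUnits ℚ) = QuotientGroup.mk 1) : 0 < (x : ℚ) := by
  obtain ⟨s, hs, he⟩ := exists_eq_mul_sq_of_mk_eq_mk hx.symm
  rw [he, Units.val_one, one_mul]; positivity

/-- The bits left by the residue-kernel lemma: not `κ₁`'s, not `κ₂`'s ⟹ `0`'s or `κ₃`'s. [folklore] -/
private theorem residuePair_solve (ra rb t : ZMod 2) (h1 : ¬ (ra = 1 ∧ rb = t + 1)) (h2 : ¬ (ra = t ∧ rb = 1)) :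
    (ra = 0 ∧ rb = 0) ∨ (ra = t + 1 ∧ rb = t) := by
  revert ra rb t; decide

/-- **Residue pairs of positive Selmer classes of the rank-zero base.** For `E` with rational `2`-torsion
`e₁ < e₂ < e₃`, rank `0`, `Ш(E)[2] = 0`, and a prime `q` with `qr_q(−1) = 1` at which `δ₁, δ₂` are non-residues: a
class `c ∈ Sel⁽²⁾(E/ℚ)` with components `([a],[b])`, `b > 0`, has `(qr_q(a), qr_q(b)) = (0,0)` or `= (t+1, t)`,
`t = qr_q(e₂ − e₁)` (indeed `c ∈ {0, κ(T₃)}`, the classes `κ(T₁), κ(T₂)` having negative `T₂`-component).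
[cite: SilvermanAEC2009, Prop. X.1.4, Prop. X.4.9] -/
theorem qrBit_pair_of_mem_selmerGroup_of_pos (h : E.toAffine.SplitTwoTorsion e₁ e₂ e₃) (h12 : e₁ < e₂) (h23 : e₂ < e₃)
    (hrank : E.mordellWeilRank = 0) (hsha : ∀ x ∈ E.sha, (2 : ℕ) • x = 0 → x = 0) {q : ℕ} [Fact q.Prime]
    (hm1 : qrBit q (-1 : ℚ) = 1) (hδ₁ : qrBit q ((e₁ - e₂) * (e₁ - e₃)) = 1) (hδ₂ : qrBit q ((e₂ - e₁) * (e₂ - e₃)) = 1)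
    {c : galH1Torsion E 2} (hc : c ∈ E.selmerGroup 2) (a b : ℚˣ)
    (ha : kummerEquiv ℚ 2 (E.twoTorsionCharH1 h c) = Additive.ofMul (QuotientGroup.mk a))
    (hb : kummerEquiv ℚ 2 (E.twoTorsionCharH1 h.swap₁₂ c) = Additive.ofMul (QuotientGroup.mk b)) (hbpos : 0 < (b : ℚ)) :
    (qrBit q (a : ℚ) = 0 ∧ qrBit q (b : ℚ) = 0) ∨
      (qrBit q (a : ℚ) = qrBit q (e₂ - e₁) + 1 ∧ qrBit q (b : ℚ) = qrBit q (e₂ - e₁)) := by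
  have he12 : e₁ - e₂ ≠ 0 := sub_ne_zero.mpr h.ne₁₂
  have he21 : e₂ - e₁ ≠ 0 := sub_ne_zero.mpr h.ne₁₂.symm
  have he13 : e₁ - e₃ ≠ 0 := sub_ne_zero.mpr h.ne₁₃
  have he23 : e₂ - e₃ ≠ 0 := sub_ne_zero.mpr h.ne₂₃
  set t := qrBit q (e₂ - e₁) with ht
  have ht' : qrBit q (e₁ - e₂) = t + 1 := by
    rw [show e₁ - e₂ = (-1) * (e₂ - e₁) by ring, qrBit_mul q (by norm_num) he21, hm1, ht, add_comm]
  -- the torsion classes `κ₁, κ₂`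
  have hκ₁S := twoDescentClass_mem_selmerGroup_T₁ E h (Units.mk0 _ (mul_ne_zero he12 he13)) (Units.mk0 _ he12) rfl rfl
  have hκ₂S := twoDescentClass_mem_selmerGroup_T₂ E h (Units.mk0 _ he21) (Units.mk0 _ (mul_ne_zero he21 he23)) rfl rfl
  -- not `κ₁`'s residues: else `c + κ₁ = 0`, `[b (e₁ - e₂)] = 1`, but `b (e₁ - e₂) < 0`
  have hK1 : ¬ (qrBit q (a : ℚ) = 1 ∧ qrBit q (b : ℚ) = t + 1) := by
    rintro ⟨hqa, hqb⟩
    have ha' := E.kummerEquiv_twoTorsionCharH1_add h a (Units.mk0 _ (mul_ne_zero he12 he13)) ha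
      (E.kummerEquiv_twoTorsionCharH1_twoDescentClass h _ (Units.mk0 _ he12))
    have hb' := E.kummerEquiv_twoTorsionCharH1_add h.swap₁₂ b (Units.mk0 _ he12) hb
      (E.kummerEquiv_twoTorsionCharH1_swap_twoDescentClass h (Units.mk0 _ (mul_ne_zero he12 he13)) _)
    have h0 := E.eq_zero_of_mem_selmerGroup_of_qrBit_eq_zero h hrank hsha hm1 hδ₁ hδ₂ (add_mem hc hκ₁S) _ _ ha' hb'
      (by rw [Units.val_mul, Units.val_mk0, qrBit_mul q a.ne_zero (mul_ne_zero he12 he13), hqa, hδ₁]; decide)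
      (by rw [Units.val_mul, Units.val_mk0, qrBit_mul q b.ne_zero he12, hqb, ht']; generalize t = x; revert x; decide)
    rw [h0, _root_.map_zero, _root_.map_zero] at hb'
    have h1 : (QuotientGroup.mk (b * Units.mk0 _ he12) : SqUnits ℚ) = QuotientGroup.mk 1 := by
      rw [QuotientGroup.mk_one]; exact Additive.ofMul.injective (hb'.symm.trans ofMul_one.symm)
    have hpos := pos_of_mk_eq_one h1
    rw [Units.val_mul, Units.val_mk0] at hpos
    have : (e₁ : ℚ) - e₂ < 0 := by linarith
    nlinarith
  -- not `κ₂`'s residues: else `c + κ₂ = 0`, `[b δ₂] = 1`, but `b δ₂ < 0`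
  have hK2 : ¬ (qrBit q (a : ℚ) = t ∧ qrBit q (b : ℚ) = 1) := by
    rintro ⟨hqa, hqb⟩
    have ha' := E.kummerEquiv_twoTorsionCharH1_add h a (Units.mk0 _ he21) ha
      (E.kummerEquiv_twoTorsionCharH1_twoDescentClass h _ (Units.mk0 _ (mul_ne_zero he21 he23)))
    have hb' := E.kummerEquiv_twoTorsionCharH1_add h.swap₁₂ b (Units.mk0 _ (mul_ne_zero he21 he23)) hb
      (E.kummerEquiv_twoTorsionCharH1_swap_twoDescentClass h (Units.mk0 _ he21) _)
    have h0 := E.eq_zero_of_mem_selmerGroup_of_qrBit_eq_zero h hrank hsha hm1 hδ₁ hδ₂ (add_mem hc hκ₂S) _ _ ha' hb'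
      (by rw [Units.val_mul, Units.val_mk0, qrBit_mul q a.ne_zero he21, hqa, ← ht]; generalize t = x; revert x; decide)
      (by rw [Units.val_mul, Units.val_mk0, qrBit_mul q b.ne_zero (mul_ne_zero he21 he23), hqb, hδ₂]; decide)
    rw [h0, _root_.map_zero, _root_.map_zero] at hb'
    have h1 : (QuotientGroup.mk (b * Units.mk0 _ (mul_ne_zero he21 he23)) : SqUnits ℚ) = QuotientGroup.mk 1 := by
      rw [QuotientGroup.mk_one]; exact Additive.ofMul.injective (hb'.symm.trans ofMul_one.symm)
    have hpos := pos_of_mk_eq_one h1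
    rw [Units.val_mul, Units.val_mk0] at hpos
    have h1' : (0 : ℚ) < e₂ - e₁ := by linarith
    have h2' : e₂ - e₃ < (0 : ℚ) := by linarith
    have : (e₂ - e₁) * (e₂ - e₃) < 0 := mul_neg_of_pos_of_neg h1' h2'
    nlinarith
  exact residuePair_solve _ _ t hK1 hK2

end Base

end Summit.BirchSwinnertonDyer.BirchSwinnertonDyer.Theorems.GenusKolyvaginAtTwo.TorsionCellD0

end
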